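import Mathlib
import Summits.ValiantsHypothesis.ValiantsHypothesis.Theorems.NewtonUnitEquationsNewtonTauWeakRefineDissociate

/-!
# `NewtonUnitEquationsNewtonTauWeakPenalisedFace` — strict positive minimisers of the minimum-size face survive a dominant size penalty

Registered stub `stub_penalisedFace` (P3 of `RungC7b`) of line `binomial-normal-form` (crux `NewtonTauWeak`,
stmt-ValiantsHypothesis-5904, lead c7, wave 2, `Cruxes/NewtonTauWeak/Lines/binomial_normal_form.lean`).

Setting.  A finite family `F` of indices `T` with points `p T ∈ ℕ²` (as `Fin 2 →₀ ℕ`), sizes `s T ∈ ℕ` with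
`s₀ ≤ s T` on `F`, and a constant `Cst` with `p T 0 + p T 1 < Cst` on `F`.  The penalised cloud is
`{p T + (Cst · s T) • (1,1) : T ∈ F}`, embedded in `ℝ²` by `e ↦ (i ↦ (e i : ℝ))`.

Claim.  The number of points `q = p T` (`T ∈ F`, `s T = s₀`) that are, for some `w` with `w 0, w 1 > 0`, the STRICT
minimiser of `x ↦ w 0 · x 0 + w 1 · x 1` among the points of the size-`s₀` members of `F` is at most the number of
extreme points of the convex hull of the embedded penalised cloud.

Proof.  The map `q ↦ emb (q + (Cst · s₀) • (1,1))` is injective, and it sends each such `q` to the strict minimiser of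
`x ↦ w 0 · x 0 + w 1 · x 1` over the penalised cloud (`PenalisedFaceAux.penalised_lt`): for a competitor `T'` with
`s T' = s₀` the penalty is common (and `p T' ≠ q`, else the penalised points coincide); for `s T' ≥ s₀ + 1` the value
is `≥ Cst (s₀ + 1)(w 0 + w 1) > w·q + Cst s₀ (w 0 + w 1)` because `w·q < (w 0 + w 1) Cst` (`q 0, q 1 < Cst`).  A strict
minimiser of a linear functional over a finite set `S ⊆ ℕ²` embeds to an extreme point of `conv(emb '' S)`
(`RefineDissociateAux.emb_mem_extremePoints_of_strict` in direction `-w`), and `Set.ncard_le_ncard_of_injOn`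
concludes (the extreme points lie in the finite embedded cloud, `extremePoints_convexHull_subset`).

Everything is folklore; no named facts, no citations, no `def`s.
-/

-- Sub = Summit single-conjunct layout: the duplicated namespace component is mandated by the tree.
set_option linter.dupNamespace false

noncomputable section

open scoped BigOperators

namespace Summit.ValiantsHypothesis.ValiantsHypothesis.Theorems.NewtonUnitEquationsNewtonTauWeak

namespace PenalisedFaceAux

/-- First coordinate of a penalised point: `(x + m • (1,1)) 0 = x 0 + m`. [folklore] -/
theorem penalise_apply_zero (x : Fin 2 →₀ ℕ) (m : ℕ) :
    (x + m • (Finsupp.single 0 1 + Finsupp.single 1 1) : Fin 2 →₀ ℕ) 0 = x 0 + m := by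
  simp

/-- Second coordinate of a penalised point: `(x + m • (1,1)) 1 = x 1 + m`. [folklore] -/
theorem penalise_apply_one (x : Fin 2 →₀ ℕ) (m : ℕ) :
    (x + m • (Finsupp.single 0 1 + Finsupp.single 1 1) : Fin 2 →₀ ℕ) 1 = x 1 + m := by
  simp

/-- The penalisation `x ↦ x + m • (1,1)` is injective. [folklore] -/
theorem penalise_injective (m : ℕ) :
    Function.Injective fun x : Fin 2 →₀ ℕ => x + m • (Finsupp.single 0 1 + Finsupp.single 1 1) :=
  fun _ _ h => add_right_cancel h

/-- The real embedding `e ↦ (i ↦ (e i : ℝ))` of `ℕ²` is injective. [folklore] -/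
theorem emb_injective :
    Function.Injective fun e : Fin 2 →₀ ℕ => fun i : Fin 2 => ((e i : ℕ) : ℝ) := by
  intro x y hxy
  ext i
  have hi := congr_fun hxy i
  dsimp only at hi
  exact_mod_cast hi

/-- **Key inequality.**  With positive weights `w 0, w 1`, a point `q` with `q 0 + q 1 < Cst` penalised by `Cst · s₀`
is strictly below (for `x ↦ w 0 · x 0 + w 1 · x 1`) any point `p'` with non-negative coordinates penalised by
`Cst · s'`, `s' ≥ s₀ + 1`: `w·q < (w 0 + w 1) Cst ≤ w·p' + (w 0 + w 1) Cst (s' - s₀)`. [folklore] -/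
theorem penalised_lt_of_lt {w₀ w₁ q₀ q₁ p₀ p₁ C s₀ s' : ℝ} (hw₀ : 0 < w₀) (hw₁ : 0 < w₁)
    (hq₀ : q₀ < C) (hq₁ : q₁ < C) (hp₀ : 0 ≤ p₀) (hp₁ : 0 ≤ p₁) (hs : C * s₀ + C ≤ C * s') :
    w₀ * (q₀ + C * s₀) + w₁ * (q₁ + C * s₀) < w₀ * (p₀ + C * s') + w₁ * (p₁ + C * s') := by
  have e1 := mul_le_mul_of_nonneg_left hs hw₀.le
  have e2 := mul_le_mul_of_nonneg_left hs hw₁.le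
  have e3 := mul_lt_mul_of_pos_left hq₀ hw₀
  have e4 := mul_lt_mul_of_pos_left hq₁ hw₁
  have e5 := mul_nonneg hw₀.le hp₀
  have e6 := mul_nonneg hw₁.le hp₁
  linarith

/-- **Penalised strict minimisers.**  If `q = p T` (`T ∈ F`) strictly minimises
`x ↦ w 0 · x 0 + w 1 · x 1` (`w 0, w 1 > 0`) among the points of the size-`s₀` members, then `q + (Cst s₀) • (1,1)`
strictly minimises it over the whole penalised cloud `{p T' + (Cst · s T') • (1,1) : T' ∈ F}`. [folklore] -/
theorem penalised_lt {ι : Type} (F : Finset ι) (p : ι → Fin 2 →₀ ℕ) (s : ι → ℕ) (s₀ Cst : ℕ)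
    (hs : ∀ T ∈ F, s₀ ≤ s T) (hC : ∀ T ∈ F, p T 0 + p T 1 < Cst) {q : Fin 2 →₀ ℕ} {T : ι} (hT : T ∈ F)
    (hpT : p T = q) (w : Fin 2 → ℝ) (hw0 : 0 < w 0) (hw1 : 0 < w 1)
    (hstrict : ∀ T' ∈ F, s T' = s₀ → p T' ≠ q →
      w 0 * ((q 0 : ℕ) : ℝ) + w 1 * ((q 1 : ℕ) : ℝ) < w 0 * ((p T' 0 : ℕ) : ℝ) + w 1 * ((p T' 1 : ℕ) : ℝ))
    {T' : ι} (hT' : T' ∈ F)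
    (hne : p T' + (Cst * s T') • (Finsupp.single 0 1 + Finsupp.single 1 1) ≠
      q + (Cst * s₀) • (Finsupp.single 0 1 + Finsupp.single 1 1)) :
    w 0 * (((q 0 : ℕ) : ℝ) + (Cst : ℝ) * (s₀ : ℝ)) + w 1 * (((q 1 : ℕ) : ℝ) + (Cst : ℝ) * (s₀ : ℝ)) <
      w 0 * (((p T' 0 : ℕ) : ℝ) + (Cst : ℝ) * (s T' : ℝ)) +
        w 1 * (((p T' 1 : ℕ) : ℝ) + (Cst : ℝ) * (s T' : ℝ)) := by
  by_cases hsT' : s T' = s₀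
  · -- same size: the penalty is common, and the points differ
    have hpq : p T' ≠ q := fun h => hne (by rw [h, hsT'])
    have hlt := hstrict T' hT' hsT' hpq
    rw [hsT']
    linarith
  · -- larger size: the extra penalty `Cst` dominates `w·q < (w 0 + w 1) Cst`
    have h1 : Cst * s₀ + Cst ≤ Cst * s T' := by
      have h2 : s₀ + 1 ≤ s T' := by have := hs T' hT'; omega
      calc Cst * s₀ + Cst = Cst * (s₀ + 1) := by ring
        _ ≤ Cst * s T' := Nat.mul_le_mul_left _ h2
    have h1' : (Cst : ℝ) * s₀ + Cst ≤ (Cst : ℝ) * s T' := by exact_mod_cast h1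
    have hq : q 0 + q 1 < Cst := by simpa [hpT] using hC T hT
    have hq0 : ((q 0 : ℕ) : ℝ) < Cst := by exact_mod_cast (by omega : q 0 < Cst)
    have hq1 : ((q 1 : ℕ) : ℝ) < Cst := by exact_mod_cast (by omega : q 1 < Cst)
    exact penalised_lt_of_lt hw0 hw1 hq0 hq1 (Nat.cast_nonneg _) (Nat.cast_nonneg _) h1'

end PenalisedFaceAux

/-- **Stub P3 of line `binomial-normal-form` (`RungC7b`): strict positive minimisers of the minimum-size face survive a
dominant size penalty.**  Finite family `F`, points `p T ∈ ℕ²`, sizes `s T ≥ s₀` on `F`, and `Cst > p T 0 + p T 1`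
on `F`.  Every point `q = p T` (`T ∈ F`, `s T = s₀`) that is the STRICT minimiser of `w₀ x₀ + w₁ x₁` over the points of
the size-`s₀` members, for some `w` with `w₀, w₁ > 0`, yields the extreme point `q + (Cst s₀)•(1,1)` of the hull of the
penalised cloud `{p T + (Cst·s T)•(1,1) : T ∈ F}` (`PenalisedFaceAux.penalised_lt` and
`RefineDissociateAux.emb_mem_extremePoints_of_strict` in direction `-w`); `q ↦ q + (Cst s₀)•(1,1)` and the embedding
are injective, so `Set.ncard_le_ncard_of_injOn` concludes (the extreme points lie in the finite image). [folklore] -/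
theorem stub_penalisedFace {ι : Type} (F : Finset ι) (p : ι → Fin 2 →₀ ℕ) (s : ι → ℕ) (s₀ Cst : ℕ)
    (hs : ∀ T ∈ F, s₀ ≤ s T) (hC : ∀ T ∈ F, p T 0 + p T 1 < Cst) :
    {q : Fin 2 →₀ ℕ | ∃ T ∈ F, s T = s₀ ∧ p T = q ∧ ∃ w : Fin 2 → ℝ, 0 < w 0 ∧ 0 < w 1 ∧
        ∀ T' ∈ F, s T' = s₀ → p T' ≠ q →
          w 0 * ((q 0 : ℕ) : ℝ) + w 1 * ((q 1 : ℕ) : ℝ) <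
            w 0 * ((p T' 0 : ℕ) : ℝ) + w 1 * ((p T' 1 : ℕ) : ℝ)}.ncard ≤
      (Set.extremePoints ℝ (convexHull ℝ ((fun e : Fin 2 →₀ ℕ => fun i : Fin 2 => ((e i : ℕ) : ℝ)) ''
        ((F.image fun T => p T + (Cst * s T) • (Finsupp.single 0 1 + Finsupp.single 1 1) :
          Finset (Fin 2 →₀ ℕ)) : Set (Fin 2 →₀ ℕ))))).ncard := by
  classical
  refine Set.ncard_le_ncard_of_injOn
    (fun q : Fin 2 →₀ ℕ => fun i : Fin 2 =>
      (((q + (Cst * s₀) • (Finsupp.single 0 1 + Finsupp.single 1 1) : Fin 2 →₀ ℕ) i : ℕ) : ℝ))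
    ?_ ?_ (((F.image _).finite_toSet.image _).subset extremePoints_convexHull_subset)
  · -- each strict positive minimiser of the minimum-size face gives a vertex of the penalised hull
    rintro q ⟨T, hT, hsT, hpT, w, hw0, hw1, hstrict⟩
    have hqS : q + (Cst * s₀) • (Finsupp.single 0 1 + Finsupp.single 1 1) ∈
        F.image (fun T => p T + (Cst * s T) • (Finsupp.single 0 1 + Finsupp.single 1 1)) :=
      Finset.mem_image.2 ⟨T, hT, by simp only [hpT, hsT]⟩
    refine RefineDissociateAux.emb_mem_extremePoints_of_strict _ hqS ![-w 0, -w 1] fun x hx hne => ?_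
    obtain ⟨T', hT', rfl⟩ := Finset.mem_image.1 hx
    have hk := PenalisedFaceAux.penalised_lt F p s s₀ Cst hs hC hT hpT w hw0 hw1 hstrict hT' hne
    simp only [Fin.sum_univ_two, Matrix.cons_val_zero, Matrix.cons_val_one,
      PenalisedFaceAux.penalise_apply_zero, PenalisedFaceAux.penalise_apply_one, Nat.cast_add, Nat.cast_mul]
    linarith
  · -- the map is injective
    intro q _ q' _ h
    exact PenalisedFaceAux.penalise_injective (Cst * s₀) (PenalisedFaceAux.emb_injective h)

end Summit.ValiantsHypothesis.ValiantsHypothesis.Theorems.NewtonUnitEquationsNewtonTauWeak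

end
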